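import Summits.AtomisticToContinuum.Crystallization.Theses.ChessboardParticlePlanes
import Summits.AtomisticToContinuum.Crystallization.Theorems.PhononSlackCertificatesHullBridgeWindowsOfGluing
import Summits.AtomisticToContinuum.Crystallization.Theorems.PhononSlackCertificatesHullBridgeCleanCentres
import Summits.AtomisticToContinuum.Crystallization.Theorems.ReggeStarCoercivityDefectFreeCrystallizesLayeredGluing
import Summits.AtomisticToContinuum.Crystallization.Theorems.PhononSlackCertificatesPeriodicGivenLayered

/-!
# Crux `PeriodicWindows` (stmt-AtomisticToContinuum-3240), line `Sketch` — the LOCAL-STATISTICS bridge (cross-cone)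

Lead c5 (prover-line-stmt-AtomisticToContinuum-3240-c5-0). The line's own bridge
(`…PeriodicWindowsOfGoodWindows.lean`) feeds the crux from WINDOW statements (a.e. GOOD `(R, ε)`-windows at every
scale — board items 14293 ∧ 14294 of route `LaminarSixThreeThree`). This file records, as one theorem on THIS crux
item, that the tree ALREADY holds a purely PER-PARTICLE structural interface to the same crux, assembled from the
landed machinery of the sibling cones `PhononSlackCertificates` / `ReggeStarCoercivity`:

* `HullBridgeExact.stub_cleanCentres` (counting + the landed Lennard-Jones minimal distance): if the fraction of
  particles that are not two-shell good (`IsTwoShellGood (1/20) (47/50) 1`: the `3a/2`-neighbourhood is two-way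
  `a/20`-matched with a rotated fcc/hcp two-shell pattern at a scale `a ∈ [47/50, 1]`) tends to `0`, and for every
  `η > 0` the fraction of particles whose `2`-ball is not `η`-layered-near (`PrestressSplitKorn.LayeredNear η`)
  tends to `0`, then clean centres of every radius exist eventually;
* `HullBridgeExact.stub_windowsOfGluing` over the landed gluing lemma `PrestressSplitKorn.stub_layeredGluing`
  (compactness in the local matching topology + exact local-to-global rigidity of box-layered sets): clean centres
  give layered windows at every scale (the conclusion of `LayeredWindows`, stmt-11778, for that sequence);
* `LayeredHull.PeriodicGivenLayered_of` (stmt-11779, landed): layered windows give periodic windows.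

So `PeriodicWindows` follows from the two a.e. SHELL STATISTICS of Lennard-Jones ground states below — radius
`3a/2` and radius `2` predicates, no window-wide laminarity, no `ε → 0` inside the hypotheses beyond `∀ η`.
[folklore] bookkeeping; `--supports stmt-AtomisticToContinuum-3240`.
-/

noncomputable section

namespace Summit.AtomisticToContinuum.Crystallization.Theorems.PeriodicWindowsSketch

open scoped Classical
open Filter Topology
open Literature.MathematicalPhysics.StatisticalMechanics Literature.Geometry.DiscreteGeometry
open Summit.AtomisticToContinuum.Crystallization.Theses.ChessboardParticlePlanes (PeriodicWindows)
open Summit.AtomisticToContinuum.Crystallization.Theorems.PrestressSplitKorn (LayeredNear stub_layeredGluing)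

/-- **BRIDGE (proved): a.e. shell statistics ⇒ the crux `PeriodicWindows`.** If for every sequence of
Lennard-Jones ground states (i) the fraction of particles that are not `1/20`-two-shell-good on the scale window
`[47/50, 1]` tends to `0` and (ii) for every `η > 0` the fraction of particles whose `2`-ball is not `η`-layered-near
tends to `0`, then `PeriodicWindows` holds. Composition of `HullBridgeExact.stub_cleanCentres`,
`HullBridgeExact.stub_windowsOfGluing PrestressSplitKorn.stub_layeredGluing` and `LayeredHull.PeriodicGivenLayered_of`
(all landed). [folklore] -/
theorem PeriodicWindows_of_shellStatistics
    (hgood : ∀ x : (N : ℕ) → (Fin N → EuclideanSpace ℝ (Fin 3)), (∀ N, IsGroundState lennardJones (x N)) →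
      Tendsto (fun N : ℕ =>
        (Nat.card {i : Fin N // ¬ IsTwoShellGood (1 / 20) (47 / 50) 1 (x N) i} : ℝ) / N) atTop (𝓝 0))
    (hlay : ∀ x : (N : ℕ) → (Fin N → EuclideanSpace ℝ (Fin 3)), (∀ N, IsGroundState lennardJones (x N)) →
      ∀ η : ℝ, 0 < η → Tendsto (fun N : ℕ =>
        ((Finset.univ.filter fun i : Fin N => ¬ LayeredNear η (x N) i).card : ℝ) / N) atTop (𝓝 0)) :
    PeriodicWindows := fun x hx =>
  LayeredHull.PeriodicGivenLayered_of x hx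
    (HullBridgeExact.stub_windowsOfGluing stub_layeredGluing x hx
      (fun _η hη R' => HullBridgeExact.stub_cleanCentres x hx (hgood x hx) (hlay x hx) hη R'))

end Summit.AtomisticToContinuum.Crystallization.Theorems.PeriodicWindowsSketch

end
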